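import Mathlib
import Summits.Ventures.HodgeRepro2.HodgePeterssonBridge
import Summits.Ventures.HodgeRepro2.NonVanishingPeterssonCompact
import Summits.Ventures.HodgeRepro2.BallQuotientMeasureCanonical

/-!
# NonVanishingHodgePeriod — from the Tier-3 hypothesis shape to a non-zero `(N)`-period

Blind cell `pub-hodge-repro2`, seat p2 (Tier 5, sub-step N1 = IDENTIFICATION).

`Hypothesis.lean` (row 1 of this seat's annex) states the Tier-3 period input as the Prop
`NonVanishingInput K τ₁ H 𝔪 Q` (the conclusion shape of Shimura 1979, Thm 8.1: a finite-index
subgroup `Γ` of `Γ_1`, two closed holomorphic `Γ`-invariant 1-forms `q₁, q₂` on the ball with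
`q₁ ∧ q₂ ≢ 0`). `NonVanishingPeterssonCompact.lean` (row 111) turned it into a weight-3 form of
POSITIVE Petersson norm on a torsion-free congruence subgroup `S' ⊆ Γ_N` (`N > 2`), given only
that `Γ_1\𝔹²` is compact; `HodgePeterssonBridge.lean` identified the coefficient-model period
`∫ ω_f ∧ \overline{ω_g}` with `4 ×` the Petersson product.

This file composes the two: under `NonVanishingInput` and the compactness of `Γ_1\𝔹²`, there are
a torsion-free `S' ⊆ Γ_N`, a holomorphic weight-3 form `f` for `S'` with `f ≢ 0` on the ball, and a
MEASURABLE fundamental domain `D` of `S'` such that the `(N)`-shaped period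
`∫_D ω_f ∧ \overline{ω_f}` has positive real part, and `∫_D ω_f ∧ \overline{c · ω_f} ≠ 0 ⟺ c ≠ 0`
(Lemma A7.1, «in particular», for the pair `(ω_ab, ω_cd) = (ω_f, c · ω_f)`).
-/

namespace Summit.Ventures.HodgeRepro2.ShimuraData

open MeasureTheory

variable {K : Type*} [Field K] [NumberField K] [NumberField.IsCMField K] {τ₁ : K →+* ℂ}
  {H : Matrix (Fin 3) (Fin 3) K} {Q : Matrix (Fin 3) (Fin 3) ℂ} {𝔪 : Submodule ℤ (Fin 3 → K)}

/-- **The Tier-3 input gives a non-zero `(N)`-period.** Under `NonVanishingInput` (the shape of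
Shimura's Thm 8.1 conclusion), `N > 2`, and the compactness of `Γ_1\𝔹²` (anisotropy — prose),
there are a torsion-free congruence subgroup `S' ⊆ Γ_N`, a holomorphic weight-3 form `f` for `S'`
not vanishing identically on the ball, and a measurable fundamental domain `D` of `S'` with
`S'\𝔹²` compact, such that the coefficient-model period `∫_D ω_f ∧ \overline{ω_f}` has positive
real part and `∫_D ω_f ∧ \overline{c · ω_f} ≠ 0 ⟺ c ≠ 0` for every `c : ℂ`. -/
theorem NonVanishingInput.exists_setIntegral_hodgeWedge_self_re_pos (hH : IsHermitianForm K H)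
    (hdef : ∀ τ : K →+* ℂ, NumberField.InfinitePlace.mk τ ≠ NumberField.InfinitePlace.mk τ₁ →
      IsDefiniteAt K τ H)
    (hQ : IsFrame K τ₁ H Q) (h𝔪 : IsLattice K 𝔪) (hnv : NonVanishingInput K τ₁ H 𝔪 Q) {N : ℕ}
    (hN : 2 < N)
    [CompactSpace (ballQuotient hQ (shimuraLevelSubgroup K H 𝔪 1)
      (shimuraLevelSubgroup_one_subset_unitaryGroup H 𝔪))] :
    ∃ S' : Subgroup (GL (Fin 3) K), ∃ hS' : (S' : Set (GL (Fin 3) K)) ⊆ shimuraLevel K H 𝔪 N,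
      IsTorsionFreeSet K (S' : Set (GL (Fin 3) K)) ∧
      CompactSpace (ballQuotient hQ S' (subset_unitaryGroup_of_subset_shimuraLevel hS')) ∧
      ∃ f : (Fin 2 → ℂ) → ℂ, IsWeightFor τ₁ Q S' 3 f ∧ DifferentiableOn ℂ f ball₂ ∧
        (∃ z₀ ∈ ball₂, f z₀ ≠ 0) ∧
        ∃ D : Set ball₂, MeasurableSet D ∧
          IsBallFundamentalDomain hQ S' (subset_unitaryGroup_of_subset_shimuraLevel hS') D ∧
          0 < (∫ x in Subtype.val '' D, hodgeWedge f f x).re ∧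
          ∀ c : ℂ, (∫ x in Subtype.val '' D, hodgeWedge f (c • f) x ≠ 0 ↔ c ≠ 0) := by
  obtain ⟨S', hS', htf, hfi, f, hf, hdiff, ⟨z₀, hz₀, h0⟩, -, -, -⟩ :=
    hnv.exists_setIntegral_petersson_pos_of_compactSpace hH hdef hQ h𝔪 hN
  have hle : S' ≤ shimuraLevelSubgroup K H 𝔪 1 := by
    intro γ hγ
    have h1 : (S' : Set (GL (Fin 3) K)) ⊆ shimuraLevelSubgroup K H 𝔪 1 := by
      rw [coe_shimuraLevelSubgroup]
      exact hS'.trans (shimuraLevel_subset_of_dvd H 𝔪 (Nat.one_dvd N))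
    exact h1 hγ
  haveI := hfi
  haveI : CompactSpace (ballQuotient hQ S' (subset_unitaryGroup_of_subset_shimuraLevel hS')) :=
    compactSpace_ballQuotient_of_le hQ hle (shimuraLevelSubgroup_one_subset_unitaryGroup H 𝔪)
  obtain ⟨D, hDm, hD⟩ := exists_isBallFundamentalDomain hH hdef hQ h𝔪 hS' htf
  have hfc : ContinuousOn f ball₂ := hdiff.continuousOn
  refine ⟨S', hS', htf, inferInstance, f, hf, hdiff, ⟨z₀, hz₀, h0⟩, D, hDm, hD,
    setIntegral_hodgeWedge_self_re_pos hQ S' _ hD hDm hf hfc hz₀ h0, fun c => ?_⟩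
  rw [setIntegral_hodgeWedge_smul_ne_zero_iff hQ S' _ hD hDm hf hfc c]
  exact ⟨fun h => h.1, fun h => ⟨h, z₀, hz₀, h0⟩⟩

/-- **The bridge against the canonical measure.** For a torsion-free congruence subgroup `S ⊆ Γ_N`
and a measurable fundamental domain `D`, the coefficient-model period over `D` equals `4 ×` the
Petersson inner product against the CANONICAL measure `ballQuotientMeasure` of `S\𝔹²`
(independent of `D`). -/
theorem setIntegral_hodgeWedge_eq_peterssonInner_ballQuotientMeasure (hH : IsHermitianForm K H)
    (hdef : ∀ τ : K →+* ℂ, NumberField.InfinitePlace.mk τ ≠ NumberField.InfinitePlace.mk τ₁ →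
      IsDefiniteAt K τ H)
    (hQ : IsFrame K τ₁ H Q) (h𝔪 : IsLattice K 𝔪) {N : ℕ} {S : Subgroup (GL (Fin 3) K)}
    (hS : (S : Set (GL (Fin 3) K)) ⊆ shimuraLevel K H 𝔪 N)
    (htf : IsTorsionFreeSet K (S : Set (GL (Fin 3) K))) {D : Set ball₂} (hDm : MeasurableSet D)
    (hD : IsBallFundamentalDomain hQ S (subset_unitaryGroup_of_subset_shimuraLevel hS) D)
    {f g : (Fin 2 → ℂ) → ℂ} (hf : IsWeightFor τ₁ Q S 3 f) (hg : IsWeightFor τ₁ Q S 3 g)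
    (hfc : ContinuousOn f ball₂) (hgc : ContinuousOn g ball₂) :
    ∫ x in Subtype.val '' D, hodgeWedge f g x
      = 4 * peterssonInner hQ S _ (ballQuotientMeasure hH hdef hQ h𝔪 hS htf) hf hg := by
  rw [setIntegral_hodgeWedge_eq_peterssonInner hQ S _ hDm hf hg hfc hgc,
    ballQuotientMeasure_eq hH hdef hQ h𝔪 hS htf hD]

end Summit.Ventures.HodgeRepro2.ShimuraData
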